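import Summits.AtomisticToContinuum.BoseEinsteinCondensation.Theses.BECWallDressingTransfer
import Literature.MathematicalPhysics.QuantumManyBody.GroundState
import Literature.MathematicalPhysics.QuantumManyBody.SwapPurity
import Literature.MathematicalPhysics.QuantumManyBody.CondensateOccupationStability
import Summits.AtomisticToContinuum.BoseEinsteinCondensation.Theorems.BECInsertionVarianceGroundStateAccessibleExistence
import Summits.AtomisticToContinuum.BoseEinsteinCondensation.Theorems.BECThomsonPrinciplePeriodicToDirichletInnerFlatToBEC

/-!
# Crux `BoundaryTransferWeak` (stmt-AtomisticToContinuum-0827, routes `BECInsertionCorrector` /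
# `BECPeriodicReduction`), line `Sketch` (coupled-bath-relocation): stub `stub_closing`

**The per-potential closing chain.** For ONE repulsive finite-range `v`, granted `L²`-rigidity of
Dirichlet near-minimisers up to phase (`BECWallDressingTransfer.GroundStateRigidity`, taken as a
hypothesis): if, eventually in `n`, `E₀(n+1, L_{n+1}) < ⊤` and the Dirichlet ground state
`Ψ_D = groundState v (n+1) L_{n+1}` occupies the normalised flat mode of the inner cube
`(L/4, 3L/4)³` by `≥ κ(n+1)`, then `HasGroundStateBEC v ρ` (with constant `κ/16`). Three moves:

1. ground state ⇒ condensed trial states at every slack (`Ψ_D` is an `L²`-limit of trial states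
   whose energies have `liminf ≤ E₀`; `√occ_φ` is `√N‖φ‖₂`-Lipschitz in `L²`, so some trial state
   within any `ε` of `E₀` has `occ_φ ≥ (κ/4)(n+1)`);
2. + rigidity (`η = (κ/4)/16`) ⇒ every `δ`-near-minimiser has `occ_φ ≥ (κ/16)(n+1)`
   (phase-blindness of `occ_φ`, the same Lipschitz bound);
3. the inner flat mode is a normalised measurable one-body mode, so `occ_φ ≤ λ_max(γ)`
   (`occupation_le_maxOccupation`) and `le_condensateNumber` give
   `condensateNumber ≥ (κ/16)(n+1)`; the index shift `n + 1 ↦ N` is `Filter.map_add_atTop_eq_nat`.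

Patterns: the tree files `…/Theorems/BECThomsonPrinciplePeriodicToDirichletCondensedFromGroundState.lean`
(a.e. seminorm property of `√occ_φ`, the bound `occ_φ ≤ N‖φ‖₂²‖·‖₂²`, the bookkeeping
`√(cN) ≤ b + √(cN)/4 ⇒ (c/4)N ≤ b²`; private there, re-proved here),
`…NearMinimiserTransfer.lean` and `…InnerFlatToBEC.lean`. [folklore]
-/

noncomputable section

namespace Summit.AtomisticToContinuum.BoseEinsteinCondensation.CoupledBaths

open Literature.MathematicalPhysics.QuantumManyBody.BoseGas MeasureTheory Filter
open Summit.AtomisticToContinuum.BoseEinsteinCondensation.Theses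
open Summit.AtomisticToContinuum.BoseEinsteinCondensation.TorusInTheBox
open Summit.AtomisticToContinuum.BoseEinsteinCondensation.Theorems.BECInsertionVariance
open scoped ENNReal NNReal ComplexConjugate

/-! ### `√occ_φ` is a seminorm bounded by `√N ‖φ‖₂ ‖·‖₂` (a.e. form) -/

-- adapted from BECThomsonPrinciplePeriodicToDirichletCondensedFromGroundState.lean
-- (`measurable_integral_conj_mul_vecCons'`, private there)
/-- `Y ↦ a_φ(Ψ)(Y) = ∫ conj φ(x) Ψ(x::Y) dx` is measurable for measurable `φ`, `Ψ`. [folklore] -/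
private theorem measurable_integral_conj_mul_vecCons {φ : Space → ℂ} (hφ : Measurable φ) {n : ℕ}
    {Ψ : Config (n + 1) → ℂ} (hΨ : Measurable Ψ) :
    Measurable fun Y : Config n => ∫ x, conj (φ x) * Ψ (Matrix.vecCons x Y) := by
  have h : StronglyMeasurable (Function.uncurry fun (Y : Config n) (x : Space) =>
      conj (φ x) * Ψ (Matrix.vecCons x Y)) := by
    refine Measurable.stronglyMeasurable ?_
    exact (Complex.continuous_conj.measurable.comp (hφ.comp measurable_snd)).mul
      (hΨ.comp (continuous_snd.matrixVecCons continuous_fst).measurable)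
  exact (h.integral_prod_right' (ν := (volume : Measure Space))).measurable

-- adapted from BECThomsonPrinciplePeriodicToDirichletCondensedFromGroundState.lean
-- (`ae_integrable_conj_mul_vecCons`, private there)
/-- **Slices of an `L²` function pair integrably with an `L²` mode, a.e.**: for measurable
`φ ∈ L²(ℝ³)` and measurable `Ψ ∈ L²((ℝ³)^{n+1})`, the function `x ↦ conj φ(x) Ψ(x::Y)` is
integrable for a.e. `Y ∈ (ℝ³)ⁿ` (Tonelli: `∫ dY ∫ dx |Ψ(x::Y)|² = ‖Ψ‖₂² < ∞`, so a.e. slice is in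
`L²`; then Cauchy–Schwarz). [folklore] -/
private theorem ae_integrable_conj_mul_vecCons {φ : Space → ℂ} (hφ : Measurable φ)
    (hφ2 : ∫⁻ x, (‖φ x‖₊ : ℝ≥0∞) ^ 2 ≠ ⊤) {n : ℕ} {Ψ : Config (n + 1) → ℂ} (hΨ : Measurable Ψ)
    (hΨ2 : ∫⁻ X, (‖Ψ X‖₊ : ℝ≥0∞) ^ 2 ≠ ⊤) :
    ∀ᵐ Y : Config n, Integrable (fun x => conj (φ x) * Ψ (Matrix.vecCons x Y)) := by
  have hae : ∀ᵐ Y : Config n, ∫⁻ x : Space, (‖Ψ (Matrix.vecCons x Y)‖₊ : ℝ≥0∞) ^ 2 < ⊤ :=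
    ae_lt_top (measurable_lintegral_sq_nnnorm_vecCons hΨ)
      (by rwa [lintegral_lintegral_sq_nnnorm_vecCons hΨ])
  filter_upwards [hae] with Y hY
  have hslice : Measurable fun x : Space => Ψ (Matrix.vecCons x Y) :=
    measurable_comp_vecCons_left hΨ Y
  refine ⟨((Complex.continuous_conj.measurable.comp hφ).mul hslice).aestronglyMeasurable, ?_⟩
  show ∫⁻ x, ‖conj (φ x) * Ψ (Matrix.vecCons x Y)‖ₑ < ⊤
  have heq : ∫⁻ x, ‖conj (φ x) * Ψ (Matrix.vecCons x Y)‖ₑ =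
      ∫⁻ x, (‖φ x‖₊ : ℝ≥0∞) * ‖Ψ (Matrix.vecCons x Y)‖₊ := by
    refine lintegral_congr fun x => ?_
    rw [enorm_eq_nnnorm, nnnorm_mul, ENNReal.coe_mul, RCLike.nnnorm_conj]
  have h2 : (∫⁻ x, (‖φ x‖₊ : ℝ≥0∞) * ‖Ψ (Matrix.vecCons x Y)‖₊) ^ 2 < ⊤ :=
    lt_of_le_of_lt (lintegral_mul_sq_le volume hφ.nnnorm.coe_nnreal_ennreal.aemeasurable
      hslice.nnnorm.coe_nnreal_ennreal.aemeasurable) (ENNReal.mul_lt_top hφ2.lt_top hY)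
  rw [heq]
  exact (ENNReal.pow_lt_top_iff.1 h2).resolve_right two_ne_zero

-- adapted from BECThomsonPrinciplePeriodicToDirichletCondensedFromGroundState.lean
-- (`occupation_rpow_half_le_add_ae`, private there)
/-- **`√occ_φ` is a seminorm** (a.e. form): `occ_φ(Ψ₁)^{1/2} ≤ occ_φ(Ψ₂)^{1/2} + occ_φ(Ψ₁ - Ψ₂)^{1/2}`
for measurable `N = n+1`-body functions whose slices pair integrably with `φ` for a.e. `Y`
(linearity of `a_φ(Ψ)(Y) = ∫ conj φ(x) Ψ(x::Y) dx` in `Ψ` for a.e. `Y`, the pointwise triangle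
inequality a.e., and Minkowski in `L²((ℝ³)ⁿ)`). [folklore] -/
private theorem occupation_rpow_half_le_add_ae {φ : Space → ℂ} (hφ : Measurable φ) {n : ℕ}
    {Ψ₁ Ψ₂ : Config (n + 1) → ℂ} (hΨ₁ : Measurable Ψ₁) (hΨ₂ : Measurable Ψ₂)
    (h₁ : ∀ᵐ Y : Config n, Integrable (fun x => conj (φ x) * Ψ₁ (Matrix.vecCons x Y)))
    (h₂ : ∀ᵐ Y : Config n, Integrable (fun x => conj (φ x) * Ψ₂ (Matrix.vecCons x Y))) :
    occupation (n + 1) φ Ψ₁ ^ (1 / 2 : ℝ) ≤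
      occupation (n + 1) φ Ψ₂ ^ (1 / 2 : ℝ) +
        occupation (n + 1) φ (fun X => Ψ₁ X - Ψ₂ X) ^ (1 / 2 : ℝ) := by
  -- pointwise triangle inequality, for a.e. `Y`
  have hpt : ∀ᵐ Y : Config n, (‖∫ x, conj (φ x) * Ψ₁ (Matrix.vecCons x Y)‖₊ : ℝ≥0∞) ^ 2 ≤
      ((‖∫ x, conj (φ x) * Ψ₂ (Matrix.vecCons x Y)‖₊ : ℝ≥0∞) +
        (‖∫ x, conj (φ x) * (Ψ₁ (Matrix.vecCons x Y) - Ψ₂ (Matrix.vecCons x Y))‖₊ : ℝ≥0∞)) ^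
          2 := by
    filter_upwards [h₁, h₂] with Y hY₁ hY₂
    have hY₃ : Integrable
        (fun x => conj (φ x) * (Ψ₁ (Matrix.vecCons x Y) - Ψ₂ (Matrix.vecCons x Y))) :=
      (hY₁.sub hY₂).congr (ae_of_all _ fun x => by simp only [Pi.sub_apply, mul_sub])
    -- linearity of `a_φ`
    have hlin : ∫ x, conj (φ x) * Ψ₁ (Matrix.vecCons x Y) =
        (∫ x, conj (φ x) * Ψ₂ (Matrix.vecCons x Y)) +
          ∫ x, conj (φ x) * (Ψ₁ (Matrix.vecCons x Y) - Ψ₂ (Matrix.vecCons x Y)) := by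
      rw [← integral_add hY₂ hY₃]
      congr 1
      funext x
      ring
    have hle : (‖∫ x, conj (φ x) * Ψ₁ (Matrix.vecCons x Y)‖₊ : ℝ≥0∞) ≤
        (‖∫ x, conj (φ x) * Ψ₂ (Matrix.vecCons x Y)‖₊ : ℝ≥0∞) +
          (‖∫ x, conj (φ x) * (Ψ₁ (Matrix.vecCons x Y) - Ψ₂ (Matrix.vecCons x Y))‖₊ : ℝ≥0∞) := by
      rw [hlin]
      exact_mod_cast nnnorm_add_le _ _
    gcongr
  -- Minkowski in `L²((ℝ³)ⁿ)`
  have hm₂ : AEMeasurable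
      (fun Y : Config n => (‖∫ x, conj (φ x) * Ψ₂ (Matrix.vecCons x Y)‖₊ : ℝ≥0∞)) volume :=
    (measurable_integral_conj_mul_vecCons hφ hΨ₂).nnnorm.coe_nnreal_ennreal.aemeasurable
  have hm₃ : AEMeasurable (fun Y : Config n =>
      (‖∫ x, conj (φ x) * (Ψ₁ (Matrix.vecCons x Y) - Ψ₂ (Matrix.vecCons x Y))‖₊ : ℝ≥0∞))
      volume :=
    (measurable_integral_conj_mul_vecCons hφ (hΨ₁.sub hΨ₂)).nnnorm.coe_nnreal_ennreal.aemeasurable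
  have hmink := ENNReal.lintegral_Lp_add_le hm₂ hm₃ (by norm_num : (1 : ℝ) ≤ 2)
  simp only [Pi.add_apply, ENNReal.rpow_two] at hmink
  have hI : (∫⁻ Y : Config n,
      (‖∫ x, conj (φ x) * Ψ₁ (Matrix.vecCons x Y)‖₊ : ℝ≥0∞) ^ 2) ^ (1 / 2 : ℝ) ≤
      (∫⁻ Y : Config n,
        (‖∫ x, conj (φ x) * Ψ₂ (Matrix.vecCons x Y)‖₊ : ℝ≥0∞) ^ 2) ^ (1 / 2 : ℝ) +
      (∫⁻ Y : Config n,
        (‖∫ x, conj (φ x) * (Ψ₁ (Matrix.vecCons x Y) - Ψ₂ (Matrix.vecCons x Y))‖₊ : ℝ≥0∞) ^ 2) ^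
          (1 / 2 : ℝ) :=
    le_trans (ENNReal.rpow_le_rpow (lintegral_mono_ae hpt) (by norm_num)) hmink
  simp only [occupation]
  rw [ENNReal.mul_rpow_of_nonneg _ _ (by norm_num : (0 : ℝ) ≤ 1 / 2),
    ENNReal.mul_rpow_of_nonneg _ _ (by norm_num : (0 : ℝ) ≤ 1 / 2),
    ENNReal.mul_rpow_of_nonneg _ _ (by norm_num : (0 : ℝ) ≤ 1 / 2), ← mul_add]
  exact mul_le_mul_right hI _

-- adapted from BECThomsonPrinciplePeriodicToDirichletCondensedFromGroundState.lean
-- (`occupation_le_mul_lintegral'`, private there)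
/-- **`a_φ` is bounded by `√N ‖φ‖₂`**: `occ_φ(Ψ) ≤ N ‖φ‖₂² ‖Ψ‖₂²` for measurable `φ`, `Ψ`
(Cauchy–Schwarz in the contracted particle, then Tonelli `∫ dŶ ∫ dx |Ψ(x::Ŷ)|² = ‖Ψ‖₂²`).
[folklore] -/
private theorem occupation_le_mul_lintegral {φ : Space → ℂ} (hφ : Measurable φ) :
    ∀ {N : ℕ} {Ψ : Config N → ℂ}, Measurable Ψ →
      occupation N φ Ψ ≤
        (N : ℝ≥0∞) * (∫⁻ x, (‖φ x‖₊ : ℝ≥0∞) ^ 2) * ∫⁻ X, (‖Ψ X‖₊ : ℝ≥0∞) ^ 2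
  | 0, _, _ => by simp [occupation]
  | n + 1, Ψ, hΨ => by
    have hpt : ∀ Y : Config n, (‖∫ x, conj (φ x) * Ψ (Matrix.vecCons x Y)‖₊ : ℝ≥0∞) ^ 2 ≤
        (∫⁻ x, (‖Ψ (Matrix.vecCons x Y)‖₊ : ℝ≥0∞) ^ 2) * ∫⁻ x, (‖φ x‖₊ : ℝ≥0∞) ^ 2 := by
      intro Y
      have h := sq_nnnorm_integral_mul_conj_le (ν := (volume : Measure Space))
        (measurable_comp_vecCons_left hΨ Y).aemeasurable hφ.aemeasurable
      have hfun : (fun x => conj (φ x) * Ψ (Matrix.vecCons x Y)) =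
          fun x => Ψ (Matrix.vecCons x Y) * conj (φ x) := funext fun x => mul_comm _ _
      rwa [hfun]
    calc occupation (n + 1) φ Ψ
        = (n + 1 : ℝ≥0∞) *
            ∫⁻ Y : Config n, (‖∫ x, conj (φ x) * Ψ (Matrix.vecCons x Y)‖₊ : ℝ≥0∞) ^ 2 := rfl
      _ ≤ (n + 1 : ℝ≥0∞) * ∫⁻ Y : Config n,
            (∫⁻ x, (‖Ψ (Matrix.vecCons x Y)‖₊ : ℝ≥0∞) ^ 2) * ∫⁻ x, (‖φ x‖₊ : ℝ≥0∞) ^ 2 := by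
          gcongr with Y
          exact hpt Y
      _ = (n + 1 : ℝ≥0∞) *
            ((∫⁻ X, (‖Ψ X‖₊ : ℝ≥0∞) ^ 2) * ∫⁻ x, (‖φ x‖₊ : ℝ≥0∞) ^ 2) := by
          rw [lintegral_mul_const _ (measurable_lintegral_sq_nnnorm_vecCons hΨ),
            lintegral_lintegral_sq_nnnorm_vecCons hΨ]
      _ = ((n + 1 : ℕ) : ℝ≥0∞) * (∫⁻ x, (‖φ x‖₊ : ℝ≥0∞) ^ 2) * ∫⁻ X, (‖Ψ X‖₊ : ℝ≥0∞) ^ 2 := by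
          push_cast
          ring

/-! ### The bookkeeping `√(cN) ≤ b + √(cN)/4 ⇒ (c/4)N ≤ b²` -/

-- adapted from BECThomsonPrinciplePeriodicToDirichletNearMinimiserTransfer.lean
-- (`ofReal_quarter_mul_le_sq`, private there)
/-- If `√(cN) ≤ b + √(cN)/4` in `ℝ≥0∞` then `(c/4) N ≤ b²` (indeed `(9/16) c N ≤ b²`). [folklore] -/
private theorem ofReal_quarter_mul_le_sq {c : ℝ} (hc : 0 ≤ c) (N : ℕ) {b : ℝ≥0∞}
    (h : ENNReal.ofReal (Real.sqrt (c * N)) ≤ b + ENNReal.ofReal (Real.sqrt (c * N) / 4)) :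
    ENNReal.ofReal (c / 4 * N) ≤ b ^ 2 := by
  have hcN : 0 ≤ c * N := by positivity
  have h1 : ENNReal.ofReal (3 / 4 * Real.sqrt (c * N)) ≤ b := by
    rw [show 3 / 4 * Real.sqrt (c * N) = Real.sqrt (c * N) - Real.sqrt (c * N) / 4 by ring,
      ENNReal.ofReal_sub _ (by positivity)]
    exact tsub_le_iff_right.2 h
  calc ENNReal.ofReal (c / 4 * N) ≤ ENNReal.ofReal ((3 / 4 * Real.sqrt (c * N)) ^ 2) := by
        refine ENNReal.ofReal_le_ofReal ?_
        rw [mul_pow, Real.sq_sqrt hcN]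
        nlinarith
    _ = ENNReal.ofReal (3 / 4 * Real.sqrt (c * N)) ^ 2 := by
        rw [ENNReal.ofReal_pow (by positivity)]
    _ ≤ b ^ 2 := by gcongr

/-! ### The `L²`-transfer of mode occupation between two `L²` functions -/

/-- **Occupation transfer along an `L²`-close pair**: for a measurable mode `φ` with `‖φ‖₂ ≤ 1`
and measurable square-integrable `N = n+1`-body functions `Ψ₁, Ψ₂` with
`‖Ψ₂ - Ψ₁‖₂² ≤ c/16`, the bound `occ_φ(Ψ₁) ≥ cN` transfers to `occ_φ(Ψ₂) ≥ (c/4)N`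
(`√occ_φ` is a seminorm bounded by `√N‖φ‖₂‖·‖₂`, so `√(cN) ≤ √occ_φ(Ψ₂) + √(cN)/4`). [folklore] -/
private theorem occupation_transfer {φ : Space → ℂ} (hφ : Measurable φ)
    (hφ1 : ∫⁻ x, (‖φ x‖₊ : ℝ≥0∞) ^ 2 ≤ 1) {n : ℕ} {Ψ₁ Ψ₂ : Config (n + 1) → ℂ}
    (hΨ₁ : Measurable Ψ₁) (hΨ₂ : Measurable Ψ₂) (hΨ₁2 : ∫⁻ X, (‖Ψ₁ X‖₊ : ℝ≥0∞) ^ 2 ≠ ⊤)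
    (hΨ₂2 : ∫⁻ X, (‖Ψ₂ X‖₊ : ℝ≥0∞) ^ 2 ≠ ⊤) {c : ℝ} (hc : 0 ≤ c)
    (hocc : ENNReal.ofReal (c * (n + 1 : ℕ)) ≤ occupation (n + 1) φ Ψ₁)
    (hdist : ∫⁻ X, (‖Ψ₂ X - Ψ₁ X‖₊ : ℝ≥0∞) ^ 2 ≤ ENNReal.ofReal (c / 16)) :
    ENNReal.ofReal (c / 4 * (n + 1 : ℕ)) ≤ occupation (n + 1) φ Ψ₂ := by
  have hφ2 : ∫⁻ x, (‖φ x‖₊ : ℝ≥0∞) ^ 2 ≠ ⊤ := ne_top_of_le_ne_top ENNReal.one_ne_top hφ1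
  -- `√occ(Ψ₁) ≤ √occ(Ψ₂) + √occ(Ψ₁ - Ψ₂)`
  have hsemi := occupation_rpow_half_le_add_ae hφ hΨ₁ hΨ₂
    (ae_integrable_conj_mul_vecCons hφ hφ2 hΨ₁ hΨ₁2)
    (ae_integrable_conj_mul_vecCons hφ hφ2 hΨ₂ hΨ₂2)
  -- `occ(Ψ₁ - Ψ₂) ≤ N ‖φ‖₂² ‖Ψ₁ - Ψ₂‖₂² ≤ N c/16`
  have hsymm : ∫⁻ X, (‖Ψ₁ X - Ψ₂ X‖₊ : ℝ≥0∞) ^ 2 = ∫⁻ X, (‖Ψ₂ X - Ψ₁ X‖₊ : ℝ≥0∞) ^ 2 := by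
    refine lintegral_congr fun X => ?_
    rw [← enorm_eq_nnnorm, enorm_sub_rev, enorm_eq_nnnorm]
  have hbd : occupation (n + 1) φ (fun X => Ψ₁ X - Ψ₂ X) ≤
      ((n + 1 : ℕ) : ℝ≥0∞) * ENNReal.ofReal (c / 16) :=
    calc occupation (n + 1) φ (fun X => Ψ₁ X - Ψ₂ X)
        ≤ ((n + 1 : ℕ) : ℝ≥0∞) * (∫⁻ x, (‖φ x‖₊ : ℝ≥0∞) ^ 2) *
            ∫⁻ X, (‖Ψ₁ X - Ψ₂ X‖₊ : ℝ≥0∞) ^ 2 :=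
          occupation_le_mul_lintegral hφ (hΨ₁.sub hΨ₂)
      _ ≤ ((n + 1 : ℕ) : ℝ≥0∞) * 1 * ENNReal.ofReal (c / 16) := by
          rw [hsymm]
          gcongr
      _ = ((n + 1 : ℕ) : ℝ≥0∞) * ENNReal.ofReal (c / 16) := by rw [mul_one]
  have hkey : occupation (n + 1) φ Ψ₁ ^ (1 / 2 : ℝ) ≤
      occupation (n + 1) φ Ψ₂ ^ (1 / 2 : ℝ) +
        (((n + 1 : ℕ) : ℝ≥0∞) * ENNReal.ofReal (c / 16)) ^ (1 / 2 : ℝ) := by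
    refine hsemi.trans ?_
    gcongr
  -- bookkeeping: `√(cN) ≤ √occ(Ψ₂) + √(cN)/4`
  have hsq : ∀ x : ℝ≥0∞, (x ^ (1 / 2 : ℝ)) ^ 2 = x := fun x => by
    rw [← ENNReal.rpow_two, ← ENNReal.rpow_mul]
    norm_num
  have hcN : 0 ≤ c * ((n + 1 : ℕ) : ℝ) := by positivity
  have h1 : ENNReal.ofReal (Real.sqrt (c * ((n + 1 : ℕ) : ℝ))) ≤
      occupation (n + 1) φ Ψ₁ ^ (1 / 2 : ℝ) := by
    rw [← ofReal_rpow_half_eq_sqrt hcN]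
    exact ENNReal.rpow_le_rpow hocc (by norm_num)
  have h2 : (((n + 1 : ℕ) : ℝ≥0∞) * ENNReal.ofReal (c / 16)) ^ (1 / 2 : ℝ) =
      ENNReal.ofReal (Real.sqrt (c * ((n + 1 : ℕ) : ℝ)) / 4) := by
    rw [← ENNReal.ofReal_natCast, ← ENNReal.ofReal_mul (Nat.cast_nonneg _),
      ofReal_rpow_half_eq_sqrt (by positivity)]
    congr 1
    rw [show ((n + 1 : ℕ) : ℝ) * (c / 16) = (Real.sqrt (c * ((n + 1 : ℕ) : ℝ)) / 4) ^ 2 by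
      rw [div_pow, Real.sq_sqrt hcN]; ring]
    exact Real.sqrt_sq (by positivity)
  rw [h2] at hkey
  rw [← hsq (occupation (n + 1) φ Ψ₂)]
  exact ofReal_quarter_mul_le_sq hc (n + 1) (h1.trans hkey)

/-! ### Move 1: ground state ⇒ condensed trial states at every slack -/

/-- **From a ground state to trial states at every slack**: if a Dirichlet ground state `Ψ₀`
(a normalised minimiser of the closed form) occupies a measurable mode `φ`, `‖φ‖₂ ≤ 1`, with
`occ_φ(Ψ₀) ≥ c(m+1)`, `c > 0`, then for every `ε > 0` some trial state within `ε` of `E₀` has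
`occ_φ ≥ (c/4)(m+1)` (`Ψ₀` is an `L²`-limit of trial states with `liminf` energy `≤ E₀ < ⊤`, by
the definition of `closedEnergy` as an infimum; then `occupation_transfer`). [folklore] -/
private theorem exists_trialState_of_isGroundState {v : ℝ → ℝ≥0∞} {m : ℕ} {L : ℝ}
    {φ : Space → ℂ} (hφ : Measurable φ) (hφ1 : ∫⁻ x, (‖φ x‖₊ : ℝ≥0∞) ^ 2 ≤ 1)
    {Ψ₀ : Config (m + 1) → ℂ} (hgs : IsGroundState v L Ψ₀) {c : ℝ} (hc : 0 < c)
    (hocc : ENNReal.ofReal (c * (m + 1 : ℕ)) ≤ occupation (m + 1) φ Ψ₀) {ε : ℝ≥0∞}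
    (hε : 0 < ε) :
    ∃ Φ : TrialState (m + 1) L, energy v Φ ≤ groundStateEnergy v (m + 1) L + ε ∧
      ENNReal.ofReal (c / 4 * (m + 1 : ℕ)) ≤ occupation (m + 1) φ Φ.ψ := by
  -- the energy `E₀ < ⊤` and an approximating sequence of trial states with `liminf ≤ E₀`
  have hE : groundStateEnergy v (m + 1) L ≠ ⊤ := hgs.groundStateEnergy_ne_top
  have hlt : closedEnergy v L Ψ₀ < groundStateEnergy v (m + 1) L + ε := by
    rw [hgs.closedEnergy_eq]
    exact ENNReal.lt_add_right hE hε.ne'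
  obtain ⟨Φ, hΦ⟩ := iInf_lt_iff.1 hlt
  obtain ⟨hΦΨ, hlim⟩ := iInf_lt_iff.1 hΦ
  -- frequently the energy is below `E₀ + ε`; eventually `‖Φₙ - Ψ₀‖₂² ≤ c/16`
  have hfreq : ∃ᶠ n in atTop, energy v (Φ n) < groundStateEnergy v (m + 1) L + ε :=
    frequently_lt_of_liminf_lt (h := hlim)
  have hev : ∀ᶠ n in atTop,
      ∫⁻ X, (‖(Φ n).ψ X - Ψ₀ X‖₊ : ℝ≥0∞) ^ 2 ≤ ENNReal.ofReal (c / 16) :=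
    ENNReal.tendsto_nhds_zero.1 hΦΨ _ (ENNReal.ofReal_pos.2 (by positivity))
  obtain ⟨n, hnE, hnd⟩ := (hfreq.and_eventually hev).exists
  refine ⟨Φ n, hnE.le, ?_⟩
  have hΦm : Measurable (Φ n).ψ := (Φ n).contDiff.continuous.measurable
  have hΦ2 : ∫⁻ X, (‖(Φ n).ψ X‖₊ : ℝ≥0∞) ^ 2 ≠ ⊤ := by
    rw [(Φ n).norm_eq]
    exact ENNReal.one_ne_top
  have hΨ₀2 : ∫⁻ X, (‖Ψ₀ X‖₊ : ℝ≥0∞) ^ 2 ≠ ⊤ := by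
    rw [hgs.norm_eq]
    exact ENNReal.one_ne_top
  exact occupation_transfer hφ hφ1 hgs.measurable hΦm hΨ₀2 hΦ2 hc.le hocc hnd

/-! ### The registered stub -/

/-- **Registered stub `stub_closing`** (stub C of line `Sketch`, crux stmt-AtomisticToContinuum-0827;
the skeleton's `ClosingChain`, unfolded): per potential `v`, granted `GroundStateRigidity`, an
eventual inner-flat-mode occupation `≥ κ(n+1)` of the Dirichlet ground state at finite `E₀`
gives `HasGroundStateBEC v ρ` for `ρ` below rigidity's threshold (constant `κ/16`). [folklore] -/
theorem stub_closing :
    ∀ v : ℝ → ℝ≥0∞, IsRepulsiveFiniteRange v → BECWallDressingTransfer.GroundStateRigidity →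
    ∃ ρ₂ : ℝ, 0 < ρ₂ ∧ ∀ ρ : ℝ, 0 < ρ → ρ < ρ₂ → ∀ κ : ℝ, 0 < κ →
      (∀ᶠ n : ℕ in atTop,
        groundStateEnergy v (n + 1) (sideLength ρ (n + 1)) ≠ ⊤ ∧
        ENNReal.ofReal (κ * (n + 1 : ℕ)) ≤
          occupation (n + 1)
            (Set.indicator {x : Space | ∀ t, x t ∈ Set.Ioo (1 / 4 * sideLength ρ (n + 1)) (sideLength ρ (n + 1) - 1 / 4 * sideLength ρ (n + 1))}
              (fun _ => ((Real.sqrt (((1 - 2 * (1 / 4)) * sideLength ρ (n + 1)) ^ 3))⁻¹ : ℂ)))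
            fun Z => (groundState v (n + 1) (sideLength ρ (n + 1)) Z : ℂ)) →
      HasGroundStateBEC v ρ := by
  intro v hv hR
  obtain ⟨ρ₀, hρ₀, HR⟩ := hR v hv
  refine ⟨ρ₀, hρ₀, fun ρ hρ hρlt κ hκ hev => ⟨κ / 16, by positivity, ?_⟩⟩
  -- the chain in the `n + 1` indexing of the hypothesis
  have key : ∀ᶠ n : ℕ in atTop, ENNReal.ofReal (κ / 16 * ((n + 1 : ℕ) : ℝ)) ≤
      condensateNumber v (n + 1) (sideLength ρ (n + 1)) := by
    filter_upwards [hev, (tendsto_add_atTop_nat 1).eventually (HR ρ hρ hρlt)] with n hn hRn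
    obtain ⟨hE, hocc⟩ := hn
    -- the side `L = L_{n+1}(ρ) > 0`; the inner flat mode is measurable and normalised
    have hL : 0 < sideLength ρ (n + 1) := by
      unfold sideLength
      exact Real.rpow_pos_of_pos (div_pos (Nat.cast_pos.mpr n.succ_pos) hρ) _
    have h12 : 0 < (1 - 2 * (1 / 4 : ℝ)) * sideLength ρ (n + 1) := mul_pos (by norm_num) hL
    have hφm : Measurable
        (Set.indicator {x : Space | ∀ t, x t ∈ Set.Ioo (1 / 4 * sideLength ρ (n + 1))
            (sideLength ρ (n + 1) - 1 / 4 * sideLength ρ (n + 1))}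
          (fun _ => ((Real.sqrt (((1 - 2 * (1 / 4)) * sideLength ρ (n + 1)) ^ 3))⁻¹ : ℂ))) :=
      measurable_const.indicator (measurableSet_innerCube _ _)
    have hφ1 := lintegral_innerFlatMode_sq h12
    -- the ground state is a normalised minimiser of the closed form (`E₀ < ⊤`)
    have hgs : IsGroundState v (sideLength ρ (n + 1))
        (fun Z => (groundState v (n + 1) (sideLength ρ (n + 1)) Z : ℂ)) :=
      isGroundState_groundState_of_ne_top hE
    -- move 2: `η = (κ/4)/16`, `δ` from rigidity, the condensed competitor `Φ` at slack `δ`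
    obtain ⟨δ, hδ, hrig⟩ := hRn (κ / 4 / 16) (by positivity)
    obtain ⟨Φ, hΦE, hΦocc⟩ := exists_trialState_of_isGroundState hφm hφ1.le hgs hκ hocc hδ
    -- move 3: every `δ`-near-minimiser is inner-flat condensed, hence `condensateNumber ≥ (κ/16)N`
    refine le_condensateNumber v hδ fun Ψ hΨE => ?_
    obtain ⟨c₁, hc₁, hdist⟩ := hrig Ψ Φ hΨE hΦE
    have hΨ₁m : Measurable fun X => c₁ * Φ.ψ X := Φ.contDiff.continuous.measurable.const_mul c₁
    have hΨ₁2 : ∫⁻ X, (‖c₁ * Φ.ψ X‖₊ : ℝ≥0∞) ^ 2 ≠ ⊤ := by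
      simp_rw [coe_nnnorm_mul_sq]
      rw [lintegral_const_mul' _ _ (ENNReal.pow_ne_top ENNReal.coe_ne_top), Φ.norm_eq, mul_one]
      exact ENNReal.pow_ne_top ENNReal.coe_ne_top
    have hΨ₂2 : ∫⁻ X, (‖Ψ.ψ X‖₊ : ℝ≥0∞) ^ 2 ≠ ⊤ := by
      rw [Ψ.norm_eq]
      exact ENNReal.one_ne_top
    have hocc₁ : ENNReal.ofReal (κ / 4 * (n + 1 : ℕ)) ≤
        occupation (n + 1)
          (Set.indicator {x : Space | ∀ t, x t ∈ Set.Ioo (1 / 4 * sideLength ρ (n + 1))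
              (sideLength ρ (n + 1) - 1 / 4 * sideLength ρ (n + 1))}
            (fun _ => ((Real.sqrt (((1 - 2 * (1 / 4)) * sideLength ρ (n + 1)) ^ 3))⁻¹ : ℂ)))
          (fun X => c₁ * Φ.ψ X) := by
      rw [occupation_const_mul, coe_nnnorm_eq_one_of_norm_eq_one hc₁, one_pow, one_mul]
      exact hΦocc
    have hocc₂ := occupation_transfer hφm hφ1.le hΨ₁m Ψ.contDiff.continuous.measurable hΨ₁2
      hΨ₂2 (by positivity : (0 : ℝ) ≤ κ / 4) hocc₁ hdist
    rw [show κ / 4 / 4 = κ / 16 by ring] at hocc₂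
    exact hocc₂.trans
      (occupation_le_maxOccupation _ (aestronglyMeasurable_innerFlatMode _ _) hφ1)
  -- the index shift `n + 1 ↦ N`
  have h1 : ∀ᶠ N : ℕ in map (fun a => a + 1) atTop,
      ENNReal.ofReal (κ / 16 * N) ≤ condensateNumber v N (sideLength ρ N) :=
    Filter.eventually_map.2 key
  rwa [Filter.map_add_atTop_eq_nat] at h1

end Summit.AtomisticToContinuum.BoseEinsteinCondensation.CoupledBaths

end
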